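import Summits.ABC.ABC.Theorems.IneffectiveSubspaceUniformSadicTowerFourThreeSlotPillai

/-!
# `UniformSadicTowerFour` (stmt-ABC-14937), line `flat-steep-split` (lead c4): the first open
# rung `W = 3` of BoundedOmegaABC follows from the one-prime / two-base divisibility bound

Modulo the route's crux #6 the crux `UniformSadicTowerFour` is BoundedOmegaABC: abc with a
constant `C(W, ε)` on every cell `{ω(abc) ≤ W}` (`ω` = the number of distinct primes of `abc`).
The rung `W ≤ 2` is the theorem `MixedRadical.stub_omegaCounted_two`; the first OPEN rung `W = 3`
(`B₃`) is, by the structure theorem `boundedOmegaAt_three_iff_shapes`, abc with the bound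
`c < C(ε) · (pqr)^(1+ε)` on the three exponential shapes with prime bases `p, q, r` and exponents
`x, y, z ∈ ℕ`: (A) `1 + p^x q^y = r^z`, (B) `1 + p^x = q^y r^z`, (C) `p^x + q^y = r^z` (`p ≠ q`).

This file derives all three shapes (`shapeA/B/C_of_onePrimeTwoBase`) — hence `B₃`
(`boundedOmegaAt_three_of_onePrimeTwoBase`) and, through the hardness certificate
`primePillaiTwo_bounded_of_boundedOmegaAt_three`, bounded solutions of the prime-base Pillai
equation with gap `2` (`primePillaiTwo_bounded_of_onePrimeTwoBase`) — from a hypothesis in which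
only ONE prime is ever charged, the **one-prime / two-base divisibility bound** UPD(1,2): for
every `ε > 0` there is `C = C(ε)` such that for pairwise distinct primes `p, q, r` and
`Y, Z, t ∈ ℕ`

  `p^t ∣ q^Y r^Z − 1` (with `q^Y r^Z ≥ 2`)  or  `p^t ∣ r^Z − q^Y` (with `q^Y < r^Z`)
  `⟹  p^t ≤ C · (pqr)^(1+ε) · (q^Y r^Z)^ε`.

UPD(1,2) is inlined verbatim as the hypothesis `hU` of every theorem (no definition); it is an
abc-type statement and is OPEN.

**Proof (charge one prime; the squaring trick).** Fix `ε > 0`, `0 < δ ≤ min(ε, 1)/10`, the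
constant `C_U = C(δ)` of UPD and the constant `C₂ = C₂(ε)` of the cell `ω ≤ 2`.  *Main case*:
`p, q, r` pairwise distinct and `x, y, z ≥ 1`; `c` is the right-hand side, `M = pqr`.
(C) `p^x ≠ q^y`, say `q^y < p^x`; then `p^{2x} − q^{2y} = (p^x + q^y)(p^x − q^y)` is a multiple of
`r^z`, so charging `r` against the bases `q, p` (second alternative, `Y = 2y`, `Z = 2x`, `t = z`)
gives `c = r^z ≤ C_U M^(1+δ) (q^{2y} p^{2x})^δ` with `q^{2y} p^{2x} ≤ c⁴` (`shapeC_sq`).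
(A) `(p^x q^y)² − 1 = (p^x q^y + 1)(p^x q^y − 1) = r^z (p^x q^y − 1)`, so charging `r` against
`p, q` (first alternative, `Y = 2x`, `Z = 2y`, `t = z`) gives
`c = r^z ≤ C_U M^(1+δ) (p^{2x} q^{2y})^δ` with `p^{2x} q^{2y} ≤ c⁴` (`shapeA_sq`).
(B) `q^y r^z − 1 = p^x`, so charging `p` against `q, r` (first alternative, `t = x`) gives
`p^x ≤ C_U M^(1+δ) c^δ` with `c = q^y r^z = p^x + 1 ≤ 2 p^x`.
In every case `c ≤ 2 C_U M^(1+δ) X^δ` with `X ≤ c⁴`, i.e. `c ≤ L c^{4δ}` with `L = 2 C_U M^(1+δ)`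
and `4δ ≤ 2/5`, whence `c ≤ L^{1/(1−4δ)} = (2C_U)^{1/(1−4δ)} M^{(1+δ)/(1−4δ)}` (`absorb_rpow`)
with `(1+δ)/(1−4δ) ≤ 1 + ε`, as `5δ + 4εδ ≤ ε/2 + 2ε/5` (`final_lt`): the shape bound holds with
the constant `C₂ + (2C_U)^{1/(1−4δ)} + 1`.
*Degenerate case*: two of `p, q, r` coincide or an exponent vanishes.  Then `p^x q^y r^z` has at
most two prime factors (`card_primeFactors_threePow_le_two`), so the shape — the abc triple
`(1, p^x q^y, r^z)`, `(1, p^x, q^y r^z)` resp. `(p^x, q^y, r^z)` — lies in the cell `ω ≤ 2` and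
`MixedRadical.stub_omegaCounted_two` bounds it by `C₂ rad^(1+ε) ≤ C₂ M^(1+ε)`
(`radical_threePow_le`).

Sources: the crux notes of the line (`Cruxes/UniformSadicTowerFour/`, lead c4: "charge one prime
only"); the squaring trick and the real-analysis bookkeeping are elementary [folklore].  Mathlib
only (`Nat.sq_sub_sq`, `Nat.mem_primeFactors`, `Nat.radical_dvd_iff`, `Finset.card_le_two`,
`Nat.prime_eq_prime_of_dvd_pow`, `Real.rpow_sub`, `Real.rpow_mul`, `Real.mul_rpow`,
`Real.rpow_le_rpow`, `Real.rpow_le_rpow_of_exponent_le`, `div_le_iff₀`) and the landed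
`boundedOmegaAt_three_iff_shapes`, `MixedRadical.stub_omegaCounted_two`,
`primePillaiTwo_bounded_of_boundedOmegaAt_three`.  No new definitions.  Deliberately NOT here:
UPD itself and the rung `W = 3` (both OPEN, abc-type: UPD appears only as the explicit hypothesis
`hU`, the rung only as a conclusion conditional on it), the converse direction "crux ⟹ UPD", and
the other stubs of the line (other files).
-/

noncomputable section

-- `Summit.<Summit>.<Problem>` is the mandated summit-side namespace (CONVENTIONS §2); for the
-- single-conjunct summit `ABC` the two coincide, so the duplicate `ABC.ABC` is deliberate.
set_option linter.dupNamespace false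

namespace Summit.ABC.ABC.Theorems.UniformSadicTowerFour.BoundedOmega

open Literature.NumberTheory.DiophantineGeometry (IsABCTriple rad rad_def)
open Summit.ABC.ABC.Theorems.UniformSadicTowerFour.MixedRadical (stub_omegaCounted_two)
open UniqueFactorizationMonoid (radical)

/-! ## Products of three prime powers: prime factors, radical, the degenerate cell -/

/-- For primes `p, q, r`, a prime factor `s` of `p^x q^y r^z` is `p` (and then `x ≠ 0`), `q`
(and then `y ≠ 0`) or `r` (and then `z ≠ 0`): a prime dividing a product divides a factor, and a
prime dividing the prime power `b^e` equals `b`, with `e ≠ 0` since `s ∤ 1`. [folklore] -/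
private theorem mem_primeFactors_threePow {p q r x y z s : ℕ} (hp : p.Prime) (hq : q.Prime)
    (hr : r.Prime) (hs : s ∈ (p ^ x * q ^ y * r ^ z).primeFactors) :
    (s = p ∧ x ≠ 0) ∨ (s = q ∧ y ≠ 0) ∨ (s = r ∧ z ≠ 0) := by
  obtain ⟨hs', hdvd, -⟩ := Nat.mem_primeFactors.1 hs
  have key : ∀ {b e : ℕ}, b.Prime → s ∣ b ^ e → s = b ∧ e ≠ 0 := by
    intro b e hb h
    refine ⟨(Nat.prime_dvd_prime_iff_eq hs' hb).1 (hs'.dvd_of_dvd_pow h), ?_⟩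
    rintro rfl
    rw [pow_zero, Nat.dvd_one] at h
    exact hs'.one_lt.ne' h
  rcases (Nat.Prime.dvd_mul hs').1 hdvd with h | h
  · rcases (Nat.Prime.dvd_mul hs').1 h with h | h
    · exact Or.inl (key hp h)
    · exact Or.inr (Or.inl (key hq h))
  · exact Or.inr (Or.inr (key hr h))

/-- For primes `p, q, r` and exponents `x, y, z`: `rad(p^x q^y r^z) ≤ pqr`, indeed the radical
divides `pqr` because every prime factor of `p^x q^y r^z` is one of `p, q, r`
(`Nat.radical_dvd_iff`). [folklore] -/
private theorem radical_threePow_le {p q r : ℕ} (hp : p.Prime) (hq : q.Prime) (hr : r.Prime)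
    (x y z : ℕ) : radical (p ^ x * q ^ y * r ^ z) ≤ p * q * r := by
  have h0 : p * q * r ≠ 0 := mul_ne_zero (mul_ne_zero hp.ne_zero hq.ne_zero) hr.ne_zero
  refine Nat.le_of_dvd (Nat.pos_of_ne_zero h0) ((Nat.radical_dvd_iff h0).2 fun s hs => ?_)
  refine Nat.mem_primeFactors.2 ⟨Nat.prime_of_mem_primeFactors hs, ?_, h0⟩
  rcases mem_primeFactors_threePow hp hq hr hs with ⟨rfl, -⟩ | ⟨rfl, -⟩ | ⟨rfl, -⟩
  · exact dvd_mul_of_dvd_left (dvd_mul_right _ _) _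
  · exact dvd_mul_of_dvd_left (dvd_mul_left _ _) _
  · exact dvd_mul_left _ _

/-- **The degenerate cell.** If two of the primes `p, q, r` coincide or one of the exponents
`x, y, z` vanishes, then `p^x q^y r^z` has at most two prime factors: by
`mem_primeFactors_threePow` its prime factors lie in a two-element set. [folklore] -/
private theorem card_primeFactors_threePow_le_two {p q r x y z : ℕ} (hp : p.Prime)
    (hq : q.Prime) (hr : r.Prime) (h : p = q ∨ p = r ∨ q = r ∨ x = 0 ∨ y = 0 ∨ z = 0) :
    (p ^ x * q ^ y * r ^ z).primeFactors.card ≤ 2 := by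
  obtain ⟨a, b, hab⟩ : ∃ a b : ℕ, ∀ s : ℕ,
      (s = p ∧ x ≠ 0) ∨ (s = q ∧ y ≠ 0) ∨ (s = r ∧ z ≠ 0) → s = a ∨ s = b := by
    rcases h with h | h | h | h | h | h
    · exact ⟨p, r, fun s hs => by omega⟩
    · exact ⟨p, q, fun s hs => by omega⟩
    · exact ⟨p, q, fun s hs => by omega⟩
    · exact ⟨q, r, fun s hs => by omega⟩
    · exact ⟨p, r, fun s hs => by omega⟩
    · exact ⟨p, q, fun s hs => by omega⟩
  refine (Finset.card_le_card fun s hs => ?_).trans (Finset.card_le_two (a := a) (b := b))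
  rw [Finset.mem_insert, Finset.mem_singleton]
  exact hab s (mem_primeFactors_threePow hp hq hr hs)

/-- Monotonicity of the abc bound `C · R^(1+ε)` in the constant and in the radical slot: from
`c < C · m^(1+ε)`, `m ≤ R` and `0 < C ≤ C'` follows `c < C' · R^(1+ε)`. [folklore] -/
private theorem cellBound_mono {c m R : ℕ} {C C' ε : ℝ} (hε : 0 < ε) (hC : 0 < C) (hCC : C ≤ C')
    (hmR : m ≤ R) (h : (c : ℝ) < C * (m : ℝ) ^ (1 + ε)) : (c : ℝ) < C' * (R : ℝ) ^ (1 + ε) :=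
  h.trans_le (mul_le_mul hCC
    (Real.rpow_le_rpow (Nat.cast_nonneg _) (Nat.cast_le.2 hmR) (by linarith))
    (Real.rpow_nonneg (Nat.cast_nonneg _) _) (hC.le.trans hCC))

/-! ## The squaring trick: the arithmetic of the main case -/

/-- Shape (C), arithmetic of the squaring trick: if `a + b = c` and `b < a` in `ℕ`, then
`c ∣ a² − b²` (as `a² − b² = (a + b)(a − b)`, `Nat.sq_sub_sq`), `b² < a²` and `b² a² ≤ c⁴`
(both `a, b ≤ c`). [folklore] -/
private theorem shapeC_sq {a b c : ℕ} (hE : a + b = c) (hlt : b < a) :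
    c ∣ a ^ 2 - b ^ 2 ∧ b ^ 2 < a ^ 2 ∧ b ^ 2 * a ^ 2 ≤ c ^ 4 := by
  refine ⟨⟨a - b, by rw [Nat.sq_sub_sq, hE]⟩, Nat.pow_lt_pow_left hlt two_ne_zero, ?_⟩
  calc b ^ 2 * a ^ 2 ≤ c ^ 2 * c ^ 2 :=
      Nat.mul_le_mul (Nat.pow_le_pow_left (by omega) 2) (Nat.pow_le_pow_left (by omega) 2)
    _ = c ^ 4 := by rw [← pow_add]

/-- Shape (A), arithmetic of the squaring trick: if `1 + n = c` and `2 ≤ n` in `ℕ`, then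
`c ∣ n² − 1` (as `n² − 1 = (n + 1)(n − 1)`, `Nat.sq_sub_sq`), `2 ≤ n²` and `n² ≤ c⁴`.
[folklore] -/
private theorem shapeA_sq {n c : ℕ} (hE : 1 + n = c) (hn : 2 ≤ n) :
    c ∣ n ^ 2 - 1 ∧ 2 ≤ n ^ 2 ∧ n ^ 2 ≤ c ^ 4 := by
  refine ⟨⟨n - 1, ?_⟩, hn.trans (Nat.le_self_pow two_ne_zero n), ?_⟩
  · rw [← hE, Nat.add_comm 1 n, ← Nat.sq_sub_sq, one_pow]
  · calc n ^ 2 ≤ c ^ 2 := Nat.pow_le_pow_left (by omega) 2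
      _ ≤ c ^ 4 := Nat.pow_le_pow_right (by omega) (by norm_num)

/-! ## Real-analysis bookkeeping: absorbing `c^{4δ}` and the exponent `(1+δ)/(1−4δ) ≤ 1+ε` -/

/-- Absorption of a small power: if `c ≥ 1`, `θ < 1` and `c ≤ L · c^θ` in `ℝ`, then
`c ≤ L^{1/(1−θ)}` — divide by `c^θ > 0` to get `c^{1−θ} ≤ L` and raise both sides to the power
`1/(1−θ) > 0`. [folklore] -/
private theorem absorb_rpow {c L θ : ℝ} (hc : 1 ≤ c) (hθ : θ < 1) (h : c ≤ L * c ^ θ) :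
    c ≤ L ^ (1 / (1 - θ)) := by
  have hc0 : 0 < c := one_pos.trans_le hc
  have h1θ : 0 < 1 - θ := sub_pos.2 hθ
  have h1 : c ^ (1 - θ) ≤ L := by
    rw [Real.rpow_sub hc0, Real.rpow_one, div_le_iff₀ (Real.rpow_pos_of_pos hc0 θ)]
    exact h
  calc c = (c ^ (1 - θ)) ^ (1 / (1 - θ)) := by
        rw [← Real.rpow_mul hc0.le, mul_one_div_cancel h1θ.ne', Real.rpow_one]
    _ ≤ L ^ (1 / (1 - θ)) :=
        Real.rpow_le_rpow (Real.rpow_nonneg hc0.le _) h1 (one_div_pos.2 h1θ).le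

/-- The common final step of the three shapes.  Let `ε > 0`, `0 < δ ≤ min(ε, 1)/10`, `C_U, C₂ > 0`
and `M, c ≥ 1`, `0 ≤ X ≤ c⁴` in `ℝ` with `c ≤ 2 · (C_U M^(1+δ) X^δ)`.  Then `c ≤ L c^{4δ}` with
`L = 2 C_U M^(1+δ)`, so (`absorb_rpow`) `c ≤ L^{1/(1−4δ)} = (2C_U)^{1/(1−4δ)} M^{(1+δ)/(1−4δ)}
≤ (2C_U)^{1/(1−4δ)} M^(1+ε)` because `(1+δ)/(1−4δ) ≤ 1 + ε` (i.e. `5δ + 4εδ ≤ ε`) and `M ≥ 1`;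
finally `c < (C₂ + (2C_U)^{1/(1−4δ)} + 1) · M^(1+ε)`. [folklore] -/
private theorem final_lt {ε δ CU C₂ M c X : ℝ} (hε : 0 < ε) (hδ : 0 < δ) (hδ1 : δ ≤ 1 / 10)
    (hδε : δ ≤ ε / 10) (hCU : 0 < CU) (hC₂ : 0 < C₂) (hM : 1 ≤ M) (hc : 1 ≤ c)
    (h : c ≤ 2 * (CU * M ^ (1 + δ) * X ^ δ)) (hX0 : 0 ≤ X) (hX : X ≤ c ^ 4) :
    c < (C₂ + ((2 * CU) ^ (1 / (1 - 4 * δ)) + 1)) * M ^ (1 + ε) := by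
  have hc0 : 0 < c := one_pos.trans_le hc
  have hM0 : 0 < M := one_pos.trans_le hM
  have hθ : 4 * δ < 1 := by linarith
  -- `X ^ δ ≤ c ^ (4δ)`
  have hXc : X ^ δ ≤ c ^ (4 * δ) :=
    calc X ^ δ ≤ (c ^ 4) ^ δ := Real.rpow_le_rpow hX0 hX hδ.le
      _ = c ^ (4 * δ) := by rw [← Real.rpow_natCast c 4, ← Real.rpow_mul hc0.le]; norm_num
  -- `c ≤ L · c ^ (4δ)` with `L = 2 C_U M^(1+δ)`, and absorption
  have h1 : c ≤ 2 * CU * M ^ (1 + δ) * c ^ (4 * δ) :=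
    calc c ≤ 2 * (CU * M ^ (1 + δ) * X ^ δ) := h
      _ = 2 * CU * M ^ (1 + δ) * X ^ δ := by ring
      _ ≤ 2 * CU * M ^ (1 + δ) * c ^ (4 * δ) := mul_le_mul_of_nonneg_left hXc (by positivity)
  have h2 : c ≤ (2 * CU * M ^ (1 + δ)) ^ (1 / (1 - 4 * δ)) := absorb_rpow hc hθ h1
  -- the exponent `(1+δ)/(1−4δ) ≤ 1+ε`
  have hexp : (1 + δ) * (1 / (1 - 4 * δ)) ≤ 1 + ε := by
    rw [mul_one_div, div_le_iff₀ (by linarith : (0 : ℝ) < 1 - 4 * δ)]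
    have : ε * δ ≤ ε * (1 / 10) := mul_le_mul_of_nonneg_left hδ1 hε.le
    nlinarith
  have h3 : (2 * CU * M ^ (1 + δ)) ^ (1 / (1 - 4 * δ)) ≤
      (2 * CU) ^ (1 / (1 - 4 * δ)) * M ^ (1 + ε) := by
    rw [Real.mul_rpow (by positivity) (by positivity), ← Real.rpow_mul hM0.le]
    exact mul_le_mul_of_nonneg_left (Real.rpow_le_rpow_of_exponent_le hM hexp) (by positivity)
  calc c ≤ (2 * CU) ^ (1 / (1 - 4 * δ)) * M ^ (1 + ε) := h2.trans h3
    _ < (2 * CU) ^ (1 / (1 - 4 * δ)) * M ^ (1 + ε) + (C₂ + 1) * M ^ (1 + ε) :=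
        lt_add_of_pos_right _ (by positivity)
    _ = (C₂ + ((2 * CU) ^ (1 / (1 - 4 * δ)) + 1)) * M ^ (1 + ε) := by ring

/-! ## The three shapes from UPD(1,2) -/

/-- **Shape (A) from UPD(1,2).** The one-prime / two-base divisibility bound (hypothesis `hU`,
see the module docstring) implies abc with the bound `r^z < C(ε) · (pqr)^(1+ε)` on shape (A)
`1 + p^x q^y = r^z` (`p, q, r` prime).  Main case (`p, q, r` distinct, `x, y, z ≥ 1`): the
squaring trick `r^z ∣ (p^x q^y)² − 1` charges the single prime `r` against the bases `p, q`
(first alternative of UPD with `Y = 2x`, `Z = 2y`, `t = z`), giving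
`r^z ≤ C_U (pqr)^(1+δ) (r^z)^{4δ}`, absorbed by `final_lt` (`δ = min(ε,1)/10`).  Degenerate case:
the abc triple `(1, p^x q^y, r^z)` lies in the cell `ω ≤ 2` (`stub_omegaCounted_two`).
[folklore] -/
theorem shapeA_of_onePrimeTwoBase
    (hU : ∀ ε : ℝ, 0 < ε → ∃ C : ℝ, 0 < C ∧ ∀ p q r : ℕ, p.Prime → q.Prime → r.Prime →
      p ≠ q → p ≠ r → q ≠ r → ∀ Y Z t : ℕ,
      (p ^ t ∣ q ^ Y * r ^ Z - 1 ∧ 2 ≤ q ^ Y * r ^ Z) ∨ (p ^ t ∣ r ^ Z - q ^ Y ∧ q ^ Y < r ^ Z) →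
      ((p ^ t : ℕ) : ℝ) ≤ C * ((p * q * r : ℕ) : ℝ) ^ (1 + ε) * ((q ^ Y * r ^ Z : ℕ) : ℝ) ^ ε) :
    ∀ ε : ℝ, 0 < ε → ∃ C : ℝ, 0 < C ∧ ∀ p q r x y z : ℕ, p.Prime → q.Prime → r.Prime →
      1 + p ^ x * q ^ y = r ^ z → ((r ^ z : ℕ) : ℝ) < C * ((p * q * r : ℕ) : ℝ) ^ (1 + ε) := by
  intro ε hε
  obtain ⟨δ, hδ0, hδ1, hδε⟩ : ∃ δ : ℝ, 0 < δ ∧ δ ≤ 1 / 10 ∧ δ ≤ ε / 10 :=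
    ⟨min ε 1 / 10, by positivity, by linarith [min_le_right ε 1], by linarith [min_le_left ε 1]⟩
  obtain ⟨C₂, hC₂, H₂⟩ := stub_omegaCounted_two ε hε
  obtain ⟨CU, hCU, HU⟩ := hU δ hδ0
  refine ⟨C₂ + ((2 * CU) ^ (1 / (1 - 4 * δ)) + 1), by positivity,
    fun p q r x y z hp hq hr hE => ?_⟩
  by_cases hdeg : p = q ∨ p = r ∨ q = r ∨ x = 0 ∨ y = 0 ∨ z = 0
  · -- degenerate cell `ω ≤ 2`: the abc triple `(1, p^x q^y, r^z)`
    have ht : IsABCTriple 1 (p ^ x * q ^ y) (r ^ z) :=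
      ⟨one_pos, mul_pos (pow_pos hp.pos x) (pow_pos hq.pos y), hE, Nat.coprime_one_left _⟩
    have hlt := H₂ 1 (p ^ x * q ^ y) (r ^ z) ht
      (by rw [one_mul]; exact card_primeFactors_threePow_le_two hp hq hr hdeg)
    exact cellBound_mono hε hC₂ (le_add_of_nonneg_right (by positivity))
      (by rw [rad_def, one_mul]; exact radical_threePow_le hp hq hr x y z) hlt
  -- main case: `p, q, r` pairwise distinct, `x, y, z ≥ 1`
  simp only [not_or] at hdeg
  obtain ⟨hpq, hpr, hqr, hx, -, -⟩ := hdeg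
  have hM1 : (1 : ℝ) ≤ ((p * q * r : ℕ) : ℝ) := by
    exact_mod_cast Nat.mul_pos (Nat.mul_pos hp.pos hq.pos) hr.pos
  have hc1 : (1 : ℝ) ≤ ((r ^ z : ℕ) : ℝ) := by exact_mod_cast Nat.one_le_pow z r hr.pos
  have hn2 : 2 ≤ p ^ x * q ^ y :=
    (hp.two_le.trans (Nat.le_self_pow hx p)).trans (Nat.le_mul_of_pos_right _ (pow_pos hq.pos y))
  have hsq : p ^ (2 * x) * q ^ (2 * y) = (p ^ x * q ^ y) ^ 2 := by ring
  obtain ⟨hdvd, h2, hX⟩ := shapeA_sq hE hn2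
  -- charge `r` against the bases `p, q`: `r^z ∣ p^(2x) q^(2y) - 1`
  have key := HU r p q hr hp hq (Ne.symm hpr) (Ne.symm hqr) hpq (2 * x) (2 * y) z
    (Or.inl (by rw [hsq]; exact ⟨hdvd, h2⟩))
  rw [show r * p * q = p * q * r by ring, hsq] at key
  exact final_lt hε hδ0 hδ1 hδε hCU hC₂ hM1 hc1
    (key.trans (le_mul_of_one_le_left (by positivity) one_le_two)) (Nat.cast_nonneg _)
    (by exact_mod_cast hX)

/-- **Shape (B) from UPD(1,2).** The one-prime / two-base divisibility bound (hypothesis `hU`)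
implies abc with the bound `q^y r^z < C(ε) · (pqr)^(1+ε)` on shape (B) `1 + p^x = q^y r^z`
(`p, q, r` prime).  Main case (`p, q, r` distinct): `p^x ∣ q^y r^z − 1 (= p^x)` charges the single
prime `p` against the bases `q, r` (first alternative of UPD with `Y = y`, `Z = z`, `t = x`),
giving `p^x ≤ C_U (pqr)^(1+δ) c^δ` with `c = q^y r^z ≤ 2 p^x`, absorbed by `final_lt`.
Degenerate case: the abc triple `(1, p^x, q^y r^z)` lies in the cell `ω ≤ 2`
(`stub_omegaCounted_two`). [folklore] -/
theorem shapeB_of_onePrimeTwoBase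
    (hU : ∀ ε : ℝ, 0 < ε → ∃ C : ℝ, 0 < C ∧ ∀ p q r : ℕ, p.Prime → q.Prime → r.Prime →
      p ≠ q → p ≠ r → q ≠ r → ∀ Y Z t : ℕ,
      (p ^ t ∣ q ^ Y * r ^ Z - 1 ∧ 2 ≤ q ^ Y * r ^ Z) ∨ (p ^ t ∣ r ^ Z - q ^ Y ∧ q ^ Y < r ^ Z) →
      ((p ^ t : ℕ) : ℝ) ≤ C * ((p * q * r : ℕ) : ℝ) ^ (1 + ε) * ((q ^ Y * r ^ Z : ℕ) : ℝ) ^ ε) :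
    ∀ ε : ℝ, 0 < ε → ∃ C : ℝ, 0 < C ∧ ∀ p q r x y z : ℕ, p.Prime → q.Prime → r.Prime →
      1 + p ^ x = q ^ y * r ^ z →
        ((q ^ y * r ^ z : ℕ) : ℝ) < C * ((p * q * r : ℕ) : ℝ) ^ (1 + ε) := by
  intro ε hε
  obtain ⟨δ, hδ0, hδ1, hδε⟩ : ∃ δ : ℝ, 0 < δ ∧ δ ≤ 1 / 10 ∧ δ ≤ ε / 10 :=
    ⟨min ε 1 / 10, by positivity, by linarith [min_le_right ε 1], by linarith [min_le_left ε 1]⟩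
  obtain ⟨C₂, hC₂, H₂⟩ := stub_omegaCounted_two ε hε
  obtain ⟨CU, hCU, HU⟩ := hU δ hδ0
  refine ⟨C₂ + ((2 * CU) ^ (1 / (1 - 4 * δ)) + 1), by positivity,
    fun p q r x y z hp hq hr hE => ?_⟩
  by_cases hdeg : p = q ∨ p = r ∨ q = r ∨ x = 0 ∨ y = 0 ∨ z = 0
  · -- degenerate cell `ω ≤ 2`: the abc triple `(1, p^x, q^y r^z)`
    have ht : IsABCTriple 1 (p ^ x) (q ^ y * r ^ z) :=
      ⟨one_pos, pow_pos hp.pos x, hE, Nat.coprime_one_left _⟩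
    have hlt := H₂ 1 (p ^ x) (q ^ y * r ^ z) ht
      (by rw [one_mul, ← mul_assoc]; exact card_primeFactors_threePow_le_two hp hq hr hdeg)
    exact cellBound_mono hε hC₂ (le_add_of_nonneg_right (by positivity))
      (by rw [rad_def, one_mul, ← mul_assoc]; exact radical_threePow_le hp hq hr x y z) hlt
  -- main case: `p, q, r` pairwise distinct
  simp only [not_or] at hdeg
  obtain ⟨hpq, hpr, hqr, -, -, -⟩ := hdeg
  have hM1 : (1 : ℝ) ≤ ((p * q * r : ℕ) : ℝ) := by
    exact_mod_cast Nat.mul_pos (Nat.mul_pos hp.pos hq.pos) hr.pos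
  have hpx : 1 ≤ p ^ x := Nat.one_le_pow x p hp.pos
  have hc1 : (1 : ℝ) ≤ ((q ^ y * r ^ z : ℕ) : ℝ) := by
    exact_mod_cast (by omega : 1 ≤ q ^ y * r ^ z)
  have h2c : ((q ^ y * r ^ z : ℕ) : ℝ) ≤ 2 * ((p ^ x : ℕ) : ℝ) := by
    exact_mod_cast (by omega : q ^ y * r ^ z ≤ 2 * p ^ x)
  have hX : ((q ^ y * r ^ z : ℕ) : ℝ) ≤ ((q ^ y * r ^ z : ℕ) : ℝ) ^ 4 := by
    exact_mod_cast Nat.le_self_pow (by norm_num) (q ^ y * r ^ z)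
  -- charge `p` against the bases `q, r`: `p^x ∣ q^y r^z - 1`
  have key := HU p q r hp hq hr hpq hpr hqr y z x (Or.inl ⟨⟨1, by omega⟩, by omega⟩)
  exact final_lt hε hδ0 hδ1 hδε hCU hC₂ hM1 hc1
    (h2c.trans (mul_le_mul_of_nonneg_left key zero_le_two)) (Nat.cast_nonneg _) hX

/-- **Shape (C) from UPD(1,2).** The one-prime / two-base divisibility bound (hypothesis `hU`)
implies abc with the bound `r^z < C(ε) · (pqr)^(1+ε)` on shape (C) `p^x + q^y = r^z` (`p, q, r`
prime, `p ≠ q`).  Main case (`p, q, r` distinct, `x, y, z ≥ 1`): `p^x ≠ q^y`, say `q^y < p^x`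
(the other case is symmetric); the squaring trick `r^z ∣ p^{2x} − q^{2y} = r^z (p^x − q^y)`
charges the single prime `r` against the bases `q, p` (second alternative of UPD with `Y = 2y`,
`Z = 2x`, `t = z`), giving `r^z ≤ C_U (pqr)^(1+δ) (r^z)^{4δ}`, absorbed by `final_lt`.
Degenerate case: the abc triple `(p^x, q^y, r^z)` lies in the cell `ω ≤ 2`
(`stub_omegaCounted_two`). [folklore] -/
theorem shapeC_of_onePrimeTwoBase
    (hU : ∀ ε : ℝ, 0 < ε → ∃ C : ℝ, 0 < C ∧ ∀ p q r : ℕ, p.Prime → q.Prime → r.Prime →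
      p ≠ q → p ≠ r → q ≠ r → ∀ Y Z t : ℕ,
      (p ^ t ∣ q ^ Y * r ^ Z - 1 ∧ 2 ≤ q ^ Y * r ^ Z) ∨ (p ^ t ∣ r ^ Z - q ^ Y ∧ q ^ Y < r ^ Z) →
      ((p ^ t : ℕ) : ℝ) ≤ C * ((p * q * r : ℕ) : ℝ) ^ (1 + ε) * ((q ^ Y * r ^ Z : ℕ) : ℝ) ^ ε) :
    ∀ ε : ℝ, 0 < ε → ∃ C : ℝ, 0 < C ∧ ∀ p q r x y z : ℕ, p.Prime → q.Prime → r.Prime →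
      p ≠ q → p ^ x + q ^ y = r ^ z →
        ((r ^ z : ℕ) : ℝ) < C * ((p * q * r : ℕ) : ℝ) ^ (1 + ε) := by
  intro ε hε
  obtain ⟨δ, hδ0, hδ1, hδε⟩ : ∃ δ : ℝ, 0 < δ ∧ δ ≤ 1 / 10 ∧ δ ≤ ε / 10 :=
    ⟨min ε 1 / 10, by positivity, by linarith [min_le_right ε 1], by linarith [min_le_left ε 1]⟩
  obtain ⟨C₂, hC₂, H₂⟩ := stub_omegaCounted_two ε hε
  obtain ⟨CU, hCU, HU⟩ := hU δ hδ0
  refine ⟨C₂ + ((2 * CU) ^ (1 / (1 - 4 * δ)) + 1), by positivity,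
    fun p q r x y z hp hq hr hpq hE => ?_⟩
  by_cases hdeg : p = q ∨ p = r ∨ q = r ∨ x = 0 ∨ y = 0 ∨ z = 0
  · -- degenerate cell `ω ≤ 2`: the abc triple `(p^x, q^y, r^z)`, coprime since `p ≠ q`
    have ht : IsABCTriple (p ^ x) (q ^ y) (r ^ z) :=
      ⟨pow_pos hp.pos x, pow_pos hq.pos y, hE,
        Nat.Coprime.pow x y ((Nat.coprime_primes hp hq).2 hpq)⟩
    have hlt := H₂ (p ^ x) (q ^ y) (r ^ z) ht (card_primeFactors_threePow_le_two hp hq hr hdeg)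
    exact cellBound_mono hε hC₂ (le_add_of_nonneg_right (by positivity))
      (by rw [rad_def]; exact radical_threePow_le hp hq hr x y z) hlt
  -- main case: `p, q, r` pairwise distinct, `x, y, z ≥ 1`
  simp only [not_or] at hdeg
  obtain ⟨-, hpr, hqr, hx, -, -⟩ := hdeg
  have hM1 : (1 : ℝ) ≤ ((p * q * r : ℕ) : ℝ) := by
    exact_mod_cast Nat.mul_pos (Nat.mul_pos hp.pos hq.pos) hr.pos
  have hc1 : (1 : ℝ) ≤ ((r ^ z : ℕ) : ℝ) := by exact_mod_cast Nat.one_le_pow z r hr.pos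
  have h2x : p ^ (2 * x) = (p ^ x) ^ 2 := pow_mul' p 2 x
  have h2y : q ^ (2 * y) = (q ^ y) ^ 2 := pow_mul' q 2 y
  have hne : p ^ x ≠ q ^ y := fun h =>
    hpq (Nat.prime_eq_prime_of_dvd_pow hp hq (by rw [← h]; exact dvd_pow_self p hx))
  rcases Nat.lt_or_gt_of_ne hne with hlt | hlt
  · -- `p^x < q^y`: charge `r` against the bases `p, q` (`r^z ∣ q^(2y) - p^(2x)`)
    obtain ⟨hdvd, hlt2, hX⟩ := shapeC_sq ((Nat.add_comm _ _).trans hE) hlt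
    have key := HU r p q hr hp hq (Ne.symm hpr) (Ne.symm hqr) hpq (2 * x) (2 * y) z
      (Or.inr (by rw [h2x, h2y]; exact ⟨hdvd, hlt2⟩))
    rw [show r * p * q = p * q * r by ring, h2x, h2y] at key
    exact final_lt hε hδ0 hδ1 hδε hCU hC₂ hM1 hc1
      (key.trans (le_mul_of_one_le_left (by positivity) one_le_two)) (Nat.cast_nonneg _)
      (by exact_mod_cast hX)
  · -- `q^y < p^x`: charge `r` against the bases `q, p` (`r^z ∣ p^(2x) - q^(2y)`)
    obtain ⟨hdvd, hlt2, hX⟩ := shapeC_sq hE hlt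
    have key := HU r q p hr hq hp (Ne.symm hqr) (Ne.symm hpr) (Ne.symm hpq) (2 * y) (2 * x) z
      (Or.inr (by rw [h2x, h2y]; exact ⟨hdvd, hlt2⟩))
    rw [show r * q * p = p * q * r by ring, h2x, h2y] at key
    exact final_lt hε hδ0 hδ1 hδε hCU hC₂ hM1 hc1
      (key.trans (le_mul_of_one_le_left (by positivity) one_le_two)) (Nat.cast_nonneg _)
      (by exact_mod_cast hX)

/-- **boundedOmegaAt_three_of_onePrimeTwoBase (`B₃` from UPD(1,2)).** The one-prime / two-base
divisibility bound (hypothesis `hU`: for distinct primes `p, q, r`,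
`p^t ∣ q^Y r^Z − 1` or `p^t ∣ r^Z − q^Y` forces `p^t ≤ C(ε) (pqr)^(1+ε) (q^Y r^Z)^ε`) implies the
first open rung `W = 3` of BoundedOmegaABC: abc with `C = C(ε)` on the cell `ω(abc) ≤ 3`.  By the
structure theorem `boundedOmegaAt_three_iff_shapes` it suffices to bound the three shapes, which
is `shapeA/B/C_of_onePrimeTwoBase`. [folklore] -/
theorem boundedOmegaAt_three_of_onePrimeTwoBase
    (hU : ∀ ε : ℝ, 0 < ε → ∃ C : ℝ, 0 < C ∧ ∀ p q r : ℕ, p.Prime → q.Prime → r.Prime →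
      p ≠ q → p ≠ r → q ≠ r → ∀ Y Z t : ℕ,
      (p ^ t ∣ q ^ Y * r ^ Z - 1 ∧ 2 ≤ q ^ Y * r ^ Z) ∨ (p ^ t ∣ r ^ Z - q ^ Y ∧ q ^ Y < r ^ Z) →
      ((p ^ t : ℕ) : ℝ) ≤ C * ((p * q * r : ℕ) : ℝ) ^ (1 + ε) * ((q ^ Y * r ^ Z : ℕ) : ℝ) ^ ε) :
    ∀ ε : ℝ, 0 < ε → ∃ C : ℝ, 0 < C ∧ ∀ a b c : ℕ, IsABCTriple a b c →
      (a * b * c).primeFactors.card ≤ 3 → (c : ℝ) < C * ((rad a b c : ℕ) : ℝ) ^ (1 + ε) :=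
  boundedOmegaAt_three_iff_shapes.mpr
    ⟨shapeA_of_onePrimeTwoBase hU, shapeB_of_onePrimeTwoBase hU, shapeC_of_onePrimeTwoBase hU⟩

/-- **primePillaiTwo_bounded_of_onePrimeTwoBase.** The one-prime / two-base divisibility bound
(hypothesis `hU`) bounds the solutions of the prime-base Pillai equation with gap `2`,
`p^x − q^y = 2` with `p, q` prime and `x, y ≥ 2` (Pillai 1936; `3³ − 5² = 2`): it yields the rung
`B₃` (`boundedOmegaAt_three_of_onePrimeTwoBase`), which is at least Pillai-hard
(`primePillaiTwo_bounded_of_boundedOmegaAt_three`). [folklore] -/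
theorem primePillaiTwo_bounded_of_onePrimeTwoBase
    (hU : ∀ ε : ℝ, 0 < ε → ∃ C : ℝ, 0 < C ∧ ∀ p q r : ℕ, p.Prime → q.Prime → r.Prime →
      p ≠ q → p ≠ r → q ≠ r → ∀ Y Z t : ℕ,
      (p ^ t ∣ q ^ Y * r ^ Z - 1 ∧ 2 ≤ q ^ Y * r ^ Z) ∨ (p ^ t ∣ r ^ Z - q ^ Y ∧ q ^ Y < r ^ Z) →
      ((p ^ t : ℕ) : ℝ) ≤ C * ((p * q * r : ℕ) : ℝ) ^ (1 + ε) * ((q ^ Y * r ^ Z : ℕ) : ℝ) ^ ε) :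
    ∃ N : ℕ, ∀ p q x y : ℕ, p.Prime → q.Prime → 2 ≤ x → 2 ≤ y → q ^ y + 2 = p ^ x →
      p ^ x ≤ N :=
  primePillaiTwo_bounded_of_boundedOmegaAt_three (boundedOmegaAt_three_of_onePrimeTwoBase hU)

end Summit.ABC.ABC.Theorems.UniformSadicTowerFour.BoundedOmega

end
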